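import Literature.NumberTheory.Automorphic.QuaternionicHeckeScalars
import Literature.NumberTheory.Automorphic.QuaternionAlgebraAdelicProofs
import Literature.NumberTheory.Automorphic.AdelicAdditiveCharacter
import Literature.NumberTheory.Automorphic.AdicCompletionCompact
import Literature.NumberTheory.Automorphic.AdelicSecondCountable
import Mathlib.MeasureTheory.Measure.Haar.Unique
import HarnessLib

/-!
# `D_𝔸ˣ = D_vˣ × D^{(v),×}`: splitting off one finite place of the adelic unit group of an algebra,
# as a topological group, and the factorisation of the Haar measure
(Gelbart, *Automorphic forms on adele groups* (1975), §10, p. 153: "`G_𝔸 = G_S × G^S`" for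
`G' = Dˣ`; Jacquet–Langlands, LNM 114 (1970), §14; Bump (1997), §3.3, Prop. 3.3.2)

Topic `NumberTheory/Automorphic`; definitions with bodies (`ScalarExtension.mapLeftLinear`,
`Quat.awayFrom`, `Quat.placeSplitting`) and theorems; no named fact, no instance.

The tree embeds the local unit group `D_vˣ = (K_v ⊗_K D)ˣ` into `D_𝔸ˣ = (𝔸_K ⊗_K D)ˣ` at a finite
place `v` (`Quat.ofLocal`, `Quat.localToAdelic`, `JacquetLanglands`), with the retraction
`Quat.toCompletionUnits_ofLocal`, the commutation of `ι_v(D_vˣ)` with the units trivial at `v`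
(`Quat.ofLocal_mul_eq_mul_ofLocal_of_toCompletionUnits_eq_one`) and the decomposition
`D_𝔸ˣ = ι_v(D_vˣ) · ker(x ↦ x_v)` (`Quat.toCompletionUnits_ofLocal_inv_mul`, `QuaternionicHeckeScalars`)
— all algebraic. This file adds the topology and packages the decomposition exactly as the tree's
`GLn.placeSplitting : GL_n(K_v) × G^{(v)} ≃ₜ* GL_n(𝔸_K)` (`GLnPlaceSplitting`) does for `GL_n`:

* `ScalarExtension.mapLeftLinear f = f ⊗ 1 : R ⊗_K D → S ⊗_K D` for a `K`-linear `f`, and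
  `ScalarExtension.continuous_mapLeftLinear` — **`f ⊗ 1` is continuous for continuous `f`**
  (module topologies; in the coordinates `R ⊗_K D ≅ R^n` of `ScalarExtension.coordHomeomorph` it is
  `f` coordinatewise, `ScalarExtension.coordLinearEquiv_mapLeftLinear`);
* `Quat.continuous_localToAdelic`, `Quat.continuous_ofLocal` — **the local embedding
  `D_vˣ →* D_𝔸ˣ` is continuous** (`ι_v : K_v → 𝔸_K` is, `continuous_adeleSingleHom`);
* `Quat.mapLeft_localToAdelic_of_ne`, `Quat.toCompletionUnits_ofLocal_of_ne` — `ι_v(D_vˣ)` is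
  trivial at every place `w ≠ v`;
* `Quat.awayFrom K D v x = ι_v(x_v)⁻¹ x ∈ ker(x ↦ x_v)`, continuous; `Quat.isClosed_ker_toCompletionUnits`;
* `Quat.placeSplitting K D v : D_vˣ × ker(x ↦ x_v) ≃ₜ* D_𝔸ˣ`, `(t, c) ↦ ι_v(t) c` — **the
  decomposition `D_𝔸ˣ = D_vˣ × D^{(v),×}` as topological groups**;
* `Quat.exists_map_placeSplitting_symm_eq_smul_prod` — **for Haar measures `ν` on `D_𝔸ˣ`, `μ_v` on
  `D_vˣ` and `μ'` on `D^{(v),×}` there is `κ > 0` with `(splitting⁻¹)_* ν = κ (μ_v ⊗ μ')`**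
  (uniqueness of Haar measure), with the `lintegral` and Bochner forms
  `Quat.exists_lintegral_eq_mul_lintegral_lintegral`, `Quat.exists_integral_eq_smul_integral_prod`.

This is the `Dˣ`-side bookkeeping for the factorisation (10.19) of the orbital integrals in
Gelbart's comparison (10.14) = (10.15) (through
`Literature.MeasureTheory.Group.exists_integral_descConj_eq_smul_mul`, `InvariantQuotientOrbitalProd`).
Part of the inline (D-0026) decomposition of
`Literature.NumberTheory.Automorphic.strong_multiplicity_one_quaternionUnits`.

## References

* S. Gelbart, *Automorphic forms on adele groups*, Ann. of Math. Studies 83 (1975), §10, p. 153 and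
  (10.19), p. 155 [Gelbart1975].
* H. Jacquet, R. P. Langlands, *Automorphic forms on GL(2)*, LNM 114 (1970), §14 [JacquetLanglands1970].
* D. Bump, *Automorphic Forms and Representations* (1997), §3.3, Prop. 3.3.2 [Bump1997].
-/

noncomputable section

open scoped TensorProduct NNReal ENNReal
open NumberField IsDedekindDomain MeasureTheory Measure

universe u

namespace Literature.NumberTheory.Automorphic

/-! ### `f ⊗ 1 : R ⊗_K D → S ⊗_K D` for a `K`-linear `f`, and its continuity -/

namespace ScalarExtension

section Linear

variable (K : Type*) [Field K] {R S : Type*} [CommRing R] [Algebra K R] [CommRing S] [Algebra K S]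
  (D : Type*) [Ring D] [Algebra K D]

variable (R) in
/-- Induction on `R ⊗_K D` through the type synonym: it suffices to treat `0`, pure tensors
`r ⊗ d` and sums (Mathlib `TensorProduct.induction_on`). [folklore] -/
theorem induction_on' {motive : ScalarExtension K R D → Prop} (X : ScalarExtension K R D)
    (zero : motive 0) (tmul : ∀ (r : R) (d : D), motive (ofTensor K R D (r ⊗ₜ[K] d)))
    (add : ∀ X Y, motive X → motive Y → motive (X + Y)) : motive X :=
  TensorProduct.induction_on (motive := fun Y : R ⊗[K] D => motive (ofTensor K R D Y)) X zero tmul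
    fun _ _ hX hY => add _ _ hX hY

variable (R) in
/-- `ofTensor` is multiplicative (it is an algebra isomorphism). [folklore] -/
theorem ofTensor_mul (a b : R ⊗[K] D) : ofTensor K R D (a * b) = ofTensor K R D a * ofTensor K R D b :=
  map_mul _ a b

variable (R) in
/-- `1 = 1 ⊗ 1` (Mathlib `Algebra.TensorProduct.one_def`). [folklore] -/
theorem one_eq_ofTensor : (1 : ScalarExtension K R D) = ofTensor K R D ((1 : R) ⊗ₜ[K] (1 : D)) := rfl

/-- **`f ⊗ 1 : R ⊗_K D → S ⊗_K D`** for a `K`-linear map `f : R → S` of commutative `K`-algebras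
(Mathlib `LinearMap.rTensor`, through the type synonym `ScalarExtension`); for `f` a `K`-algebra map
this is the linear map underlying `ScalarExtension.mapLeft`. [folklore] -/
def mapLeftLinear (f : R →ₗ[K] S) : ScalarExtension K R D →ₗ[K] ScalarExtension K S D where
  toFun := (LinearMap.rTensor D f : R ⊗[K] D →ₗ[K] S ⊗[K] D)
  map_add' X Y := (LinearMap.rTensor D f).map_add X Y
  map_smul' k X := (LinearMap.rTensor D f).map_smul k X

/-- `(f ⊗ 1)(r ⊗ x) = f r ⊗ x`. [folklore] -/
@[simp]
theorem mapLeftLinear_tmul (f : R →ₗ[K] S) (r : R) (x : D) :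
    mapLeftLinear K D f (ofTensor K R D (r ⊗ₜ[K] x)) = ofTensor K S D (f r ⊗ₜ[K] x) := rfl

variable [Module.Finite K D]

/-- The coordinates of a pure tensor: `coord(r ⊗ x)_i = r · (x_i)` for the `K`-coordinates `x_i` of
`x` in `Module.finBasis K D` (Mathlib `Algebra.TensorProduct.basis_repr_tmul`). [folklore] -/
theorem coordLinearEquiv_tmul [TopologicalSpace R] (r : R) (x : D) (i : Fin (Module.finrank K D)) :
    coordLinearEquiv K R D (ofTensor K R D (r ⊗ₜ[K] x)) i =
      r * algebraMap K R ((Module.finBasis K D).repr x i) := by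
  change (Algebra.TensorProduct.basis R (Module.finBasis K D)).equivFun (r ⊗ₜ[K] x) i = _
  rw [Module.Basis.equivFun_apply, Algebra.TensorProduct.basis_repr_tmul, Finsupp.smul_apply,
    Finsupp.mapRange_apply, smul_eq_mul]

/-- **In coordinates `f ⊗ 1` is `f` coordinatewise**: `coord((f ⊗ 1) X)_i = f(coord(X)_i)`
(`f` being `K`-linear and the coordinates `K`-rational combinations). [folklore] -/
theorem coordLinearEquiv_mapLeftLinear [TopologicalSpace R] [TopologicalSpace S] (f : R →ₗ[K] S)
    (X : ScalarExtension K R D) (i : Fin (Module.finrank K D)) :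
    coordLinearEquiv K S D (mapLeftLinear K D f X) i = f (coordLinearEquiv K R D X i) := by
  induction X using induction_on' K R D with
  | zero => simp only [map_zero, Pi.zero_apply]
  | tmul r x =>
    rw [mapLeftLinear_tmul, coordLinearEquiv_tmul, coordLinearEquiv_tmul, mul_comm r, ← Algebra.smul_def,
      map_smul, Algebra.smul_def, mul_comm]
  | add X Y hX hY => rw [map_add, map_add, Pi.add_apply, hX, hY, map_add, Pi.add_apply, map_add]

/-- **`f ⊗ 1 : R ⊗_K D → S ⊗_K D` is continuous for a continuous `K`-linear `f`** (module
topologies on both sides): in coordinates it is `f` coordinatewise. [folklore] -/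
theorem continuous_mapLeftLinear [TopologicalSpace R] [IsTopologicalRing R] [TopologicalSpace S]
    [IsTopologicalRing S] (f : R →ₗ[K] S) (hf : Continuous f) : Continuous (mapLeftLinear K D f) := by
  have h : (mapLeftLinear K D f : ScalarExtension K R D → ScalarExtension K S D) =
      (coordHomeomorph K S D).symm ∘ (fun c i => f (c i)) ∘ coordHomeomorph K R D := by
    funext X
    simp only [Function.comp_apply]
    rw [eq_comm, Homeomorph.symm_apply_eq]
    funext i
    exact (coordLinearEquiv_mapLeftLinear K D f X i).symm
  rw [h]
  exact (coordHomeomorph K S D).symm.continuous.comp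
    ((continuous_pi fun i => hf.comp (continuous_apply i)).comp (coordHomeomorph K R D).continuous)

end Linear

end ScalarExtension

/-! ### The local embedding is continuous and trivial away from `v` -/

section Place

variable (K : Type) [Field K] [NumberField K] (D : Type u) [Ring D] [Algebra K D]
  (v : HeightOneSpectrum (𝓞 K))

/-- `Quat.localToAdelic = adeleSingleLinear ⊗ 1` pointwise (definitional). [folklore] -/
theorem Quat.localToAdelic_eq_mapLeftLinear (x : ScalarExtension K (v.adicCompletion K) D) :
    Quat.localToAdelic K D v x = ScalarExtension.mapLeftLinear K D (adeleSingleLinear K v) x := rfl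

/-- **The factor inclusion `ι_v : D_v → D_𝔸` is continuous** (module topologies). [folklore] -/
theorem Quat.continuous_localToAdelic [Module.Finite K D] : Continuous (Quat.localToAdelic K D v) :=
  (ScalarExtension.continuous_mapLeftLinear K D (adeleSingleLinear K v) (continuous_adeleSingleHom K v)).congr
    fun x => (Quat.localToAdelic_eq_mapLeftLinear K D v x).symm

/-- **The local embedding `Quat.ofLocal : D_vˣ →* D_𝔸ˣ` is continuous** (units topologies). [folklore] -/
theorem Quat.continuous_ofLocal [Module.Finite K D] : Continuous (Quat.ofLocal K D v) := by
  refine Continuous.units_map _ ?_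
  change Continuous fun x : ScalarExtension K (v.adicCompletion K) D => 1 + Quat.localToAdelic K D v (x - 1)
  exact continuous_const.add ((Quat.continuous_localToAdelic K D v).comp (continuous_id.sub continuous_const))

/-- `pr_w ∘ ι_v = 0` on `D_v` for `w ≠ v`. [folklore] -/
theorem Quat.mapLeft_localToAdelic_of_ne {w : HeightOneSpectrum (𝓞 K)} (hw : w ≠ v)
    (x : ScalarExtension K (v.adicCompletion K) D) :
    ScalarExtension.mapLeft K D (adeleEvalAlgHom K w) (Quat.localToAdelic K D v x) = 0 := by
  induction x using ScalarExtension.induction_on' K (v.adicCompletion K) D with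
  | zero => rw [map_zero, map_zero]
  | tmul a y =>
    change ScalarExtension.mapLeft K D (adeleEvalAlgHom K w)
      (ScalarExtension.ofTensor K _ D (adeleSingleHom K v a ⊗ₜ[K] y)) = 0
    rw [ScalarExtension.mapLeft_tmul, adeleEvalAlgHom_apply]
    change ScalarExtension.ofTensor K _ D (AdelicGroupData.adeleEval K w (adeleSingleHom K v a) ⊗ₜ[K] y) = 0
    rw [adeleEval_adeleSingleHom_of_ne K v a hw, TensorProduct.zero_tmul, map_zero]
  | add x y hx hy => rw [map_add, map_add, hx, hy, add_zero]

/-- **`ι_v(D_vˣ)` is trivial at every place `w ≠ v`.** [folklore] -/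
theorem Quat.toCompletionUnits_ofLocal_of_ne {w : HeightOneSpectrum (𝓞 K)} (hw : w ≠ v) (g : completionUnits D v) :
    toCompletionUnits K D w (Quat.ofLocal K D v g) = 1 := by
  ext1
  change ScalarExtension.mapLeft K D (adeleEvalAlgHom K w)
    (1 + Quat.localToAdelic K D v ((g : ScalarExtension K (v.adicCompletion K) D) - 1)) = 1
  rw [map_add, map_one, Quat.mapLeft_localToAdelic_of_ne K D v hw, add_zero]

/-- **The part of `x ∈ D_𝔸ˣ` away from `v`**: `s(x) = ι_v(x_v)⁻¹ x`, the element with `v`-component `1`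
and the components of `x` elsewhere. [folklore] -/
def Quat.awayFrom (x : adelicUnits K D) : adelicUnits K D :=
  (Quat.ofLocal K D v (toCompletionUnits K D v x))⁻¹ * x

variable {K D v}

/-- `s(x)` is trivial at `v` (`Quat.toCompletionUnits_ofLocal_inv_mul`). [folklore] -/
theorem Quat.awayFrom_mem_ker [Module.Finite K D] (x : adelicUnits K D) :
    Quat.awayFrom K D v x ∈ (toCompletionUnits K D v).ker :=
  (MonoidHom.mem_ker).2 (Quat.toCompletionUnits_ofLocal_inv_mul x)

/-- `x = ι_v(x_v) s(x)`. [folklore] -/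
theorem Quat.ofLocal_mul_awayFrom (x : adelicUnits K D) :
    Quat.ofLocal K D v (toCompletionUnits K D v x) * Quat.awayFrom K D v x = x :=
  mul_inv_cancel_left _ _

/-- `s(x) = x` for `x` trivial at `v`. [folklore] -/
theorem Quat.awayFrom_eq_self_of_mem_ker {x : adelicUnits K D} (hx : x ∈ (toCompletionUnits K D v).ker) :
    Quat.awayFrom K D v x = x := by
  rw [Quat.awayFrom, (MonoidHom.mem_ker).1 hx, map_one, inv_one, one_mul]

/-- `s(ι_v(t) c) = c` for `c` trivial at `v`. [folklore] -/
theorem Quat.awayFrom_ofLocal_mul (t : completionUnits D v) {c : adelicUnits K D}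
    (hc : c ∈ (toCompletionUnits K D v).ker) : Quat.awayFrom K D v (Quat.ofLocal K D v t * c) = c := by
  rw [Quat.awayFrom, map_mul, (MonoidHom.mem_ker).1 hc, mul_one, Quat.toCompletionUnits_ofLocal,
    inv_mul_cancel_left]

variable (K D v) in
/-- `s` is continuous. [folklore] -/
theorem Quat.continuous_awayFrom [Module.Finite K D] : Continuous (Quat.awayFrom K D v) :=
  ((Quat.continuous_ofLocal K D v).comp (continuous_toCompletionUnits K D v)).inv.mul continuous_id

variable (K D v) in
/-- `ker(x ↦ x_v)` is a closed subgroup of `D_𝔸ˣ`. [folklore] -/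
theorem Quat.isClosed_ker_toCompletionUnits [Module.Finite K D] :
    IsClosed (((toCompletionUnits K D v).ker : Subgroup (adelicUnits K D)) : Set (adelicUnits K D)) := by
  haveI : T1Space (completionUnits D v) := inferInstance
  exact isClosed_singleton.preimage (continuous_toCompletionUnits K D v)

variable (K D v) in
/-- **`D_vˣ × D^{(v),×} ≃ₜ* D_𝔸ˣ`, `(t, c) ↦ ι_v(t) c`**: the internal direct product decomposition of
the adelic unit group into its `v`-component and the closed subgroup `D^{(v),×} = ker(x ↦ x_v)` of
units trivial at `v` (inverse `x ↦ (x_v, s(x))`; a homomorphism because `ι_v(D_vˣ)` commutes with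
`D^{(v),×}`). Gelbart (1975), p. 153: "`G_𝔸 = G_S × G^S`"; the tree's `GLn.placeSplitting` for `GL_n`.
[cite: Gelbart1975, §10 p. 153] -/
def Quat.placeSplitting [Module.Finite K D] :
    completionUnits D v × (toCompletionUnits K D v).ker ≃ₜ* adelicUnits K D where
  toFun p := Quat.ofLocal K D v p.1 * (p.2 : adelicUnits K D)
  invFun x := (toCompletionUnits K D v x, ⟨Quat.awayFrom K D v x, Quat.awayFrom_mem_ker x⟩)
  left_inv p := by
    rcases p with ⟨t, c⟩
    have hc : toCompletionUnits K D v (c : adelicUnits K D) = 1 := (MonoidHom.mem_ker).1 c.2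
    ext
    · simp only [map_mul, Quat.toCompletionUnits_ofLocal, hc, mul_one]
    · simp only [Quat.awayFrom_ofLocal_mul t c.2]
  right_inv x := Quat.ofLocal_mul_awayFrom x
  map_mul' p q := by
    rcases p with ⟨t, c⟩
    rcases q with ⟨t', c'⟩
    have hc : toCompletionUnits K D v (c : adelicUnits K D) = 1 := (MonoidHom.mem_ker).1 c.2
    change Quat.ofLocal K D v (t * t') * ((c * c' : (toCompletionUnits K D v).ker) : adelicUnits K D) =
      Quat.ofLocal K D v t * (c : adelicUnits K D) * (Quat.ofLocal K D v t' * (c' : adelicUnits K D))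
    rw [map_mul, Subgroup.coe_mul, mul_assoc, mul_assoc, ← mul_assoc (c : adelicUnits K D),
      ← Quat.ofLocal_mul_eq_mul_ofLocal_of_toCompletionUnits_eq_one t' hc, mul_assoc]
  continuous_toFun := ((Quat.continuous_ofLocal K D v).comp continuous_fst).mul
    (continuous_subtype_val.comp continuous_snd)
  continuous_invFun := (continuous_toCompletionUnits K D v).prodMk
    ((Quat.continuous_awayFrom K D v).subtype_mk _)

/-- `placeSplitting (t, c) = ι_v(t) c` (definitional). [folklore] -/
@[simp]
theorem Quat.placeSplitting_apply [Module.Finite K D] (p : completionUnits D v × (toCompletionUnits K D v).ker) :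
    Quat.placeSplitting K D v p = Quat.ofLocal K D v p.1 * (p.2 : adelicUnits K D) := rfl

/-- The first component of the inverse is the `v`-component. [folklore] -/
@[simp]
theorem Quat.placeSplitting_symm_apply_fst [Module.Finite K D] (x : adelicUnits K D) :
    ((Quat.placeSplitting K D v).symm x).1 = toCompletionUnits K D v x := rfl

/-- The second component of the inverse is the part away from `v`. [folklore] -/
@[simp]
theorem Quat.placeSplitting_symm_apply_snd [Module.Finite K D] (x : adelicUnits K D) :
    (((Quat.placeSplitting K D v).symm x).2 : adelicUnits K D) = Quat.awayFrom K D v x := rfl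

/-- `placeSplitting (t, 1) = ι_v(t)`. [folklore] -/
theorem Quat.placeSplitting_inl [Module.Finite K D] (t : completionUnits D v) :
    Quat.placeSplitting K D v (t, 1) = Quat.ofLocal K D v t := by
  rw [Quat.placeSplitting_apply, OneMemClass.coe_one, mul_one]

/-- `placeSplitting (1, c) = c`. [folklore] -/
theorem Quat.placeSplitting_inr [Module.Finite K D] (c : (toCompletionUnits K D v).ker) :
    Quat.placeSplitting K D v (1, c) = c := by
  rw [Quat.placeSplitting_apply, map_one, one_mul]

end Place

/-! ### Factorisation of the Haar measure of `D_𝔸ˣ` -/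

section Haar

variable (K : Type) [Field K] [NumberField K] (D : Type u) [Ring D] [Algebra K D] [Module.Finite K D]
  (v : HeightOneSpectrum (𝓞 K))

/-- **`(splitting⁻¹)_* ν = κ (μ_v ⊗ μ')` with `κ > 0`** for Haar measures `ν` on `D_𝔸ˣ`, `μ_v` on
`D_vˣ` and `μ'` on `D^{(v),×}` (the image of a Haar measure under an isomorphism of topological
groups is a Haar measure, and Haar measures on the second countable locally compact group
`D_vˣ × D^{(v),×}` are proportional; the product of Haar measures is one). The Borel structures and
the local compactness / second countability of `D_vˣ` are instance hypotheses. Gelbart (1975), p. 155: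
the measure on `G'_𝔸` is the product of the local ones ("Tamagawa measure").
[cite: Bump1997, §3.3 Prop. 3.3.2] -/
theorem Quat.exists_map_placeSplitting_symm_eq_smul_prod
    [MeasurableSpace (adelicUnits K D)] [BorelSpace (adelicUnits K D)]
    [MeasurableSpace (completionUnits D v)] [BorelSpace (completionUnits D v)]
    [SecondCountableTopology (completionUnits D v)] [LocallyCompactSpace (completionUnits D v)]
    (ν : Measure (adelicUnits K D)) [ν.IsHaarMeasure]
    (μv : Measure (completionUnits D v)) [μv.IsHaarMeasure]
    (μ' : Measure ((toCompletionUnits K D v).ker : Subgroup (adelicUnits K D))) [μ'.IsHaarMeasure] :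
    ∃ κ : ℝ≥0, 0 < κ ∧ Measure.map (Quat.placeSplitting K D v).symm ν = κ • μv.prod μ' := by
  haveI : LocallyCompactSpace (AdeleRing (𝓞 K) K) := locallyCompactSpace_adeleRing' K
  haveI : T2Space (AdeleRing (𝓞 K) K) := t2Space_adeleRing K
  haveI : LocallyCompactSpace (adelicUnits K D) := inferInstance
  haveI : T2Space (adelicUnits K D) := inferInstance
  haveI : SecondCountableTopology (adelicUnits K D) := by
    haveI := secondCountableTopology_adeleRing K
    haveI : SecondCountableTopology (ScalarExtension K (AdeleRing (𝓞 K) K) D) :=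
      (ScalarExtension.coordHomeomorph K (AdeleRing (𝓞 K) K) D).secondCountableTopology
    haveI : SecondCountableTopology (ScalarExtension K (AdeleRing (𝓞 K) K) D)ᵐᵒᵖ :=
      MulOpposite.opHomeomorph.symm.secondCountableTopology
    exact Units.isEmbedding_embedProduct.secondCountableTopology
  haveI : BorelSpace ((toCompletionUnits K D v).ker : Subgroup (adelicUnits K D)) := Subtype.borelSpace _
  haveI : SecondCountableTopology ((toCompletionUnits K D v).ker : Subgroup (adelicUnits K D)) :=
    TopologicalSpace.Subtype.secondCountableTopology _
  haveI : BorelSpace (completionUnits D v × ((toCompletionUnits K D v).ker : Subgroup (adelicUnits K D))) :=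
    Prod.borelSpace
  haveI : LocallyCompactSpace ((toCompletionUnits K D v).ker : Subgroup (adelicUnits K D)) :=
    (Quat.isClosed_ker_toCompletionUnits K D v).isClosedEmbedding_subtypeVal.locallyCompactSpace
  haveI : SigmaCompactSpace ((toCompletionUnits K D v).ker : Subgroup (adelicUnits K D)) :=
    sigmaCompactSpace_of_locallyCompact_secondCountable
  haveI : SigmaCompactSpace (completionUnits D v) := sigmaCompactSpace_of_locallyCompact_secondCountable
  haveI : SFinite μ' := inferInstance
  haveI : SFinite μv := inferInstance
  set e := (Quat.placeSplitting K D v).symm with he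
  haveI : (μv.prod μ').IsHaarMeasure := inferInstance
  haveI : (Measure.map e ν).IsHaarMeasure := e.toMulEquiv.isHaarMeasure_map ν e.continuous e.symm.continuous
  refine ⟨(Measure.map e ν).haarScalarFactor (μv.prod μ'), haarScalarFactor_pos_of_isHaarMeasure _ _, ?_⟩
  exact isMulLeftInvariant_eq_smul (Measure.map e ν) (μv.prod μ')

/-- **`∫⁻ F dν = κ ∫⁻ ∫⁻ F(ι_v(t) c) dμ_v(t) dμ'(c)`** for every measurable `F ≥ 0` (transport along the
splitting and Tonelli). [cite: Bump1997, §3.3 Prop. 3.3.2] -/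
theorem Quat.exists_lintegral_eq_mul_lintegral_lintegral
    [MeasurableSpace (adelicUnits K D)] [BorelSpace (adelicUnits K D)]
    [MeasurableSpace (completionUnits D v)] [BorelSpace (completionUnits D v)]
    [SecondCountableTopology (completionUnits D v)] [LocallyCompactSpace (completionUnits D v)]
    (ν : Measure (adelicUnits K D)) [ν.IsHaarMeasure]
    (μv : Measure (completionUnits D v)) [μv.IsHaarMeasure]
    (μ' : Measure ((toCompletionUnits K D v).ker : Subgroup (adelicUnits K D))) [μ'.IsHaarMeasure] :
    ∃ κ : ℝ≥0, 0 < κ ∧ ∀ F : adelicUnits K D → ℝ≥0∞, Measurable F →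
      ∫⁻ x, F x ∂ν = κ * ∫⁻ c, ∫⁻ t, F (Quat.ofLocal K D v t * (c : adelicUnits K D)) ∂μv ∂μ' := by
  haveI : LocallyCompactSpace (AdeleRing (𝓞 K) K) := locallyCompactSpace_adeleRing' K
  haveI : T2Space (AdeleRing (𝓞 K) K) := t2Space_adeleRing K
  haveI : T2Space (adelicUnits K D) := inferInstance
  haveI : SecondCountableTopology (adelicUnits K D) := by
    haveI := secondCountableTopology_adeleRing K
    haveI : SecondCountableTopology (ScalarExtension K (AdeleRing (𝓞 K) K) D) :=
      (ScalarExtension.coordHomeomorph K (AdeleRing (𝓞 K) K) D).secondCountableTopology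
    haveI : SecondCountableTopology (ScalarExtension K (AdeleRing (𝓞 K) K) D)ᵐᵒᵖ :=
      MulOpposite.opHomeomorph.symm.secondCountableTopology
    exact Units.isEmbedding_embedProduct.secondCountableTopology
  haveI : BorelSpace ((toCompletionUnits K D v).ker : Subgroup (adelicUnits K D)) := Subtype.borelSpace _
  haveI : SecondCountableTopology ((toCompletionUnits K D v).ker : Subgroup (adelicUnits K D)) :=
    TopologicalSpace.Subtype.secondCountableTopology _
  haveI : BorelSpace (completionUnits D v × ((toCompletionUnits K D v).ker : Subgroup (adelicUnits K D))) :=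
    Prod.borelSpace
  haveI : LocallyCompactSpace ((toCompletionUnits K D v).ker : Subgroup (adelicUnits K D)) :=
    (Quat.isClosed_ker_toCompletionUnits K D v).isClosedEmbedding_subtypeVal.locallyCompactSpace
  haveI : SigmaCompactSpace ((toCompletionUnits K D v).ker : Subgroup (adelicUnits K D)) :=
    sigmaCompactSpace_of_locallyCompact_secondCountable
  haveI : SFinite μ' := inferInstance
  obtain ⟨κ, hκ, hmap⟩ := Quat.exists_map_placeSplitting_symm_eq_smul_prod K D v ν μv μ'
  refine ⟨κ, hκ, fun F hF => ?_⟩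
  set e := (Quat.placeSplitting K D v).symm with he
  set em : adelicUnits K D ≃ᵐ completionUnits D v × ((toCompletionUnits K D v).ker : Subgroup (adelicUnits K D)) :=
    e.toHomeomorph.toMeasurableEquiv with hem
  have hem' : (em : _ → _) = e := rfl
  have hG : Measurable fun p : completionUnits D v × ((toCompletionUnits K D v).ker : Subgroup (adelicUnits K D)) =>
      F (e.symm p) := hF.comp e.symm.continuous.measurable
  have h1 : ∫⁻ x, F x ∂ν = ∫⁻ p, F (e.symm p) ∂(Measure.map e ν) := by
    rw [← hem', lintegral_map_equiv]
    simp only [hem', ContinuousMulEquiv.symm_apply_apply]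
  rw [h1, hmap, lintegral_smul_measure, lintegral_prod_symm _ hG.aemeasurable]
  congr 1

/-- **Bochner form: `∫ F dν = κ • ∫ F(ι_v(t) c) d(μ_v ⊗ μ')(t, c)`** for every `F` (both sides vanish
together when `F` is not integrable), with one `κ` for all integrands. [cite: Bump1997, §3.3 Prop. 3.3.2] -/
theorem Quat.exists_integral_eq_smul_integral_prod
    [MeasurableSpace (adelicUnits K D)] [BorelSpace (adelicUnits K D)]
    [MeasurableSpace (completionUnits D v)] [BorelSpace (completionUnits D v)]
    [SecondCountableTopology (completionUnits D v)] [LocallyCompactSpace (completionUnits D v)]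
    (ν : Measure (adelicUnits K D)) [ν.IsHaarMeasure]
    (μv : Measure (completionUnits D v)) [μv.IsHaarMeasure]
    (μ' : Measure ((toCompletionUnits K D v).ker : Subgroup (adelicUnits K D))) [μ'.IsHaarMeasure]
    {E : Type*} [NormedAddCommGroup E] [NormedSpace ℝ E] :
    ∃ κ : ℝ≥0, 0 < κ ∧ ∀ F : adelicUnits K D → E,
      ∫ x, F x ∂ν = (κ : ℝ) • ∫ p : completionUnits D v × ((toCompletionUnits K D v).ker : Subgroup (adelicUnits K D)),
        F (Quat.ofLocal K D v p.1 * (p.2 : adelicUnits K D)) ∂(μv.prod μ') := by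
  haveI : LocallyCompactSpace (AdeleRing (𝓞 K) K) := locallyCompactSpace_adeleRing' K
  haveI : T2Space (AdeleRing (𝓞 K) K) := t2Space_adeleRing K
  haveI : T2Space (adelicUnits K D) := inferInstance
  haveI : SecondCountableTopology (adelicUnits K D) := by
    haveI := secondCountableTopology_adeleRing K
    haveI : SecondCountableTopology (ScalarExtension K (AdeleRing (𝓞 K) K) D) :=
      (ScalarExtension.coordHomeomorph K (AdeleRing (𝓞 K) K) D).secondCountableTopology
    haveI : SecondCountableTopology (ScalarExtension K (AdeleRing (𝓞 K) K) D)ᵐᵒᵖ :=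
      MulOpposite.opHomeomorph.symm.secondCountableTopology
    exact Units.isEmbedding_embedProduct.secondCountableTopology
  haveI : BorelSpace ((toCompletionUnits K D v).ker : Subgroup (adelicUnits K D)) := Subtype.borelSpace _
  haveI : SecondCountableTopology ((toCompletionUnits K D v).ker : Subgroup (adelicUnits K D)) :=
    TopologicalSpace.Subtype.secondCountableTopology _
  haveI : BorelSpace (completionUnits D v × ((toCompletionUnits K D v).ker : Subgroup (adelicUnits K D))) :=
    Prod.borelSpace
  obtain ⟨κ, hκ, hmap⟩ := Quat.exists_map_placeSplitting_symm_eq_smul_prod K D v ν μv μ'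
  refine ⟨κ, hκ, fun F => ?_⟩
  set e := (Quat.placeSplitting K D v).symm with he
  set em : adelicUnits K D ≃ᵐ completionUnits D v × ((toCompletionUnits K D v).ker : Subgroup (adelicUnits K D)) :=
    e.toHomeomorph.toMeasurableEquiv with hem
  have hem' : (em : _ → _) = e := rfl
  have h1 : ∫ x, F x ∂ν = ∫ p, F (e.symm p) ∂(Measure.map e ν) := by
    rw [← hem', integral_map_equiv]
    simp only [hem', ContinuousMulEquiv.symm_apply_apply]
  rw [h1, hmap, integral_smul_nnreal_measure]
  rfl

end Haar

end Literature.NumberTheory.Automorphic
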